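import Literature.Probability.LatticeModels.DiluteLoopModel
import Mathlib.Combinatorics.SimpleGraph.Paths
import Mathlib.Combinatorics.SimpleGraph.Trails
import Mathlib.Combinatorics.SimpleGraph.Walk.Counting
import HarnessLib

/-!
# The `n = w = 0` dilute loop model is the self-avoiding walk

Topic `Literature/Probability/LatticeModels`; companion of `DiluteLoopModel.lean` (definition item
`defn-DiluteLoopModel`, sanity identity (ii) requested with it): the `n = 0` END of route
`CriticalPhenomena/SAWScalingLimit/SAWLoopFugacityFlow`.

At loop fugacity `n = 0` and collision weight `w = 0` a resolved configuration `(F, S)` of the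
dilute non-crossing loop model has non-zero weight only if it has no collision vertex and no closed
strand (`DiluteLoopModel.partitionFunction_zero_zero`). We prove that, on a subgraph `G` of `ℤ²`,
the surviving edge sets with source set `{a, b}` (`a ≠ b`) are exactly the edge sets of the
self-avoiding paths of `G` from `a` to `b` inside the volume, each counted once, so that

`Z_{0,0,x}(G, Λ; {a} ∆ {b}) = Σ_{γ : a → b self-avoiding path of G in Λ} x^{|γ|}`

(`partitionFunction_zero_zero_eq_sum_paths`), the two-point generating function of self-avoiding
walks ("the `n → 0` limit … self-avoiding walks", Jacobsen §14.3.1; Madras–Slade §1.2); with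
`Z_{0,0,x}(G, Λ; ∅) = 1` (`partitionFunction_zero_zero_empty`) the normalised two-leg function
`twoLeg ⟨0, 0, x⟩ G Λ a b` is this generating function itself. On a discretised domain `Ω_δ` every
walk from a vertex of `Ω_δ` stays in `Ω_δ`, so `domainPartitionFunction ⟨0, 0, x⟩ Ω δ ({a} ∆ {b})`
is the sum of `x^{|γ|}` over ALL self-avoiding paths of `discreteDomainGraph Ω δ` from `a` to `b`
(`domainPartitionFunction_zero_zero_eq_sum_paths`) — at `x = x_c = 1/μ` the total mass of the
critical SAW measure `SAW.weight Ω δ a b` of `RandomPlanarGeometry/SelfAvoidingWalk.lean`, whose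
normalisation is `SAW.law`.

## Contents

* `pathsIn G Λ a b` — the finite set of self-avoiding paths of `G` from `a` to `b` with all vertices
  in `Λ`;
* degree bookkeeping for the edge set of a path (`IsPath.card_filter_mem_edges_le_two`, `…_start`,
  `…_eq_zero_of_notMem`), injectivity of `p ↦ p.edges.toFinset` on paths
  (`IsPath.eq_of_edges_toFinset_eq`);
* for `G ≤ zdGraph 2`: the edge set of a path is an admissible, collision-free, loop-free
  configuration (`edgesFinset_mem_configs`, `oscVerts_edges_eq_empty`, `loops_edges_eq_zero`), and
  conversely every such configuration is the edge set of a path (`exists_path_of_loopfree`);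
* the identities `partitionFunction_zero_zero_eq_sum_paths`, `twoLeg_zero_zero_eq_sum_paths`,
  `domainPartitionFunction_zero_zero_eq_sum_paths`.

## References

* J. L. Jacobsen, LNP 775 (2009), ch. 14, §14.3.1. [Jacobsen2009]
* N. Madras, G. Slade, *The Self-Avoiding Walk* (1993), §1.2. [MadrasSlade1993]
* W. Guo, H. W. J. Blöte, B. Nienhuis, Int. J. Mod. Phys. C 10 (1999) 301, §1 (the `n = 0`
  square-lattice loop model). [GuoBloteNienhuis1999]
-/

noncomputable section

open Finset SimpleGraph
open scoped symmDiff

namespace Literature.Probability.LatticeModels.DiluteLoopModel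

/-! ### Edge sets of self-avoiding paths in a general graph -/

section General

variable {V : Type*} [DecidableEq V] {G : SimpleGraph V}

/-- A vertex off a walk lies on none of its edges. [folklore] -/
theorem card_filter_mem_edges_eq_zero_of_notMem {a b : V} (p : G.Walk a b) {z : V}
    (hz : z ∉ p.support) : #(p.edges.toFinset.filter fun e => z ∈ e) = 0 := by
  rw [card_eq_zero, filter_eq_empty_iff]
  intro e he hze
  rw [List.mem_toFinset] at he
  exact hz (Walk.mem_support_iff_exists_mem_edges.2 (Or.inr ⟨e, he, hze⟩))

/-- The starting vertex of a self-avoiding path lies on at most one of its edges. [folklore] -/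
theorem IsPath.card_filter_mem_edges_start_le {a b : V} {p : G.Walk a b} (hp : p.IsPath) :
    #(p.edges.toFinset.filter fun e => a ∈ e) ≤ 1 := by
  cases p with
  | nil => simp
  | cons h p' =>
    rw [Walk.cons_isPath_iff] at hp
    rw [Walk.edges_cons, List.toFinset_cons, filter_insert, if_pos (Sym2.mem_mk_left _ _),
      filter_eq_empty_iff.2 fun e he hae => hp.2 (Walk.mem_support_iff_exists_mem_edges.2
        (Or.inr ⟨e, List.mem_toFinset.1 he, hae⟩))]
    simp

/-- The starting vertex of a non-trivial self-avoiding path lies on exactly one of its edges.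
[folklore] -/
theorem IsPath.card_filter_mem_edges_start {a b : V} {p : G.Walk a b} (hp : p.IsPath) (hab : a ≠ b) :
    #(p.edges.toFinset.filter fun e => a ∈ e) = 1 := by
  cases p with
  | nil => exact absurd rfl hab
  | cons h p' =>
    rw [Walk.cons_isPath_iff] at hp
    rw [Walk.edges_cons, List.toFinset_cons, filter_insert, if_pos (Sym2.mem_mk_left _ _),
      filter_eq_empty_iff.2 fun e he hae => hp.2 (Walk.mem_support_iff_exists_mem_edges.2
        (Or.inr ⟨e, List.mem_toFinset.1 he, hae⟩))]
    simp

/-- Every vertex lies on at most two edges of a self-avoiding path. [folklore] -/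
theorem IsPath.card_filter_mem_edges_le_two {a b : V} {p : G.Walk a b} (hp : p.IsPath) (z : V) :
    #(p.edges.toFinset.filter fun e => z ∈ e) ≤ 2 := by
  induction p with
  | nil => simp
  | @cons u v w h p' ih =>
    rw [Walk.cons_isPath_iff] at hp
    rw [Walk.edges_cons, List.toFinset_cons, filter_insert]
    split_ifs with hz
    · refine (card_insert_le _ _).trans ?_
      have h1 : #(p'.edges.toFinset.filter fun e => z ∈ e) ≤ 1 := by
        rcases Sym2.mem_iff.1 hz with rfl | rfl
        · rw [card_filter_mem_edges_eq_zero_of_notMem p' hp.2]; exact zero_le_one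
        · exact IsPath.card_filter_mem_edges_start_le hp.1
      omega
    · exact ih hp.1

/-- The end vertex of a non-trivial self-avoiding path lies on exactly one of its edges. [folklore] -/
theorem IsPath.card_filter_mem_edges_end {a b : V} {p : G.Walk a b} (hp : p.IsPath) (hab : a ≠ b) :
    #(p.edges.toFinset.filter fun e => b ∈ e) = 1 := by
  have h := IsPath.card_filter_mem_edges_start hp.reverse (Ne.symm hab)
  rwa [Walk.edges_reverse, List.toFinset_reverse] at h

/-- Counting the elements of a duplicate-free list satisfying a predicate, as a `Finset.filter`.
[folklore] -/
theorem card_filter_toFinset_eq_countP {α : Type*} [DecidableEq α] {l : List α} (hl : l.Nodup)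
    (P : α → Prop) [DecidablePred P] : #(l.toFinset.filter P) = l.countP fun x => decide (P x) := by
  rw [List.countP_eq_length_filter, ← List.toFinset_card_of_nodup (hl.filter _)]
  congr 1
  ext x
  simp

/-- The number of edges of a self-avoiding path containing `z` is the `countP` of Mathlib's trail
lemmas. [folklore] -/
theorem IsPath.card_filter_mem_edges_eq_countP {a b : V} {p : G.Walk a b} (hp : p.IsPath) (z : V) :
    #(p.edges.toFinset.filter fun e => z ∈ e) = p.edges.countP fun e => decide (z ∈ e) :=
  card_filter_toFinset_eq_countP hp.isTrail.edges_nodup _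

/-- On a self-avoiding path from `a` to `b ≠ a`, the vertices lying on an odd number of edges are
exactly `a` and `b`. [folklore] -/
theorem IsPath.odd_card_filter_mem_edges_iff {a b : V} {p : G.Walk a b} (hp : p.IsPath) (hab : a ≠ b)
    (z : V) : Odd #(p.edges.toFinset.filter fun e => z ∈ e) ↔ z = a ∨ z = b := by
  rw [IsPath.card_filter_mem_edges_eq_countP hp, ← Nat.not_even_iff_odd,
    hp.isTrail.even_countP_edges_iff]
  tauto

/-- The edge set of a self-avoiding path has as many elements as the path has steps. [folklore] -/
theorem IsPath.card_edges_toFinset {a b : V} {p : G.Walk a b} (hp : p.IsPath) :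
    #p.edges.toFinset = p.length := by
  rw [List.toFinset_card_of_nodup hp.isTrail.edges_nodup, Walk.length_edges]

/-- **A self-avoiding path is determined by its endpoints and its edge SET.** [folklore] -/
theorem IsPath.eq_of_edges_toFinset_eq {a b : V} {p q : G.Walk a b} (hp : p.IsPath) (hq : q.IsPath)
    (h : p.edges.toFinset = q.edges.toFinset) : p = q := by
  induction p with
  | nil =>
    exact ((Walk.isPath_iff_nil.1 hq).eq_nil).symm
  | @cons a v b hav p' ih =>
    rw [Walk.cons_isPath_iff] at hp
    cases q with
    | nil =>
      exfalso
      have : s(a, v) ∈ (Walk.nil : G.Walk a a).edges.toFinset := by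
        rw [← h]; simp
      simp at this
    | @cons _ w _ haw q' =>
      rw [Walk.cons_isPath_iff] at hq
      -- the first edges agree: both are the unique edge at `a`
      have hmem : s(a, w) ∈ (Walk.cons hav p').edges.toFinset := by rw [h]; simp
      simp only [Walk.edges_cons, List.toFinset_cons, mem_insert, List.mem_toFinset] at hmem
      obtain rfl : v = w := by
        rcases hmem with he | he
        · rcases Sym2.eq_iff.1 he with ⟨-, h⟩ | ⟨h1, _⟩
          · exact h.symm
          · exact absurd h1 hav.ne
        · exact absurd (Walk.fst_mem_support_of_mem_edges p' he) hp.2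
      have hp'e : s(a, v) ∉ p'.edges.toFinset := fun he =>
        hp.2 (Walk.fst_mem_support_of_mem_edges p' (List.mem_toFinset.1 he))
      have hq'e : s(a, v) ∉ q'.edges.toFinset := fun he =>
        hq.2 (Walk.fst_mem_support_of_mem_edges q' (List.mem_toFinset.1 he))
      have h' : p'.edges.toFinset = q'.edges.toFinset := by
        simp only [Walk.edges_cons, List.toFinset_cons] at h
        rw [← erase_insert hp'e, h, erase_insert hq'e]
      rw [ih hp.1 hq.1 h']

variable [G.LocallyFinite]

/-- **The self-avoiding paths of `G` from `a` to `b` inside `Λ`** (all vertices in `Λ`), a finite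
set (their length is `< #Λ`). [cite: MadrasSlade1993, §1.2] -/
def pathsIn (G : SimpleGraph V) [G.LocallyFinite] (Λ : Finset V) (a b : V) : Finset (G.Walk a b) :=
  (G.finsetWalkLengthLT #Λ a b).filter fun p => p.IsPath ∧ ∀ v ∈ p.support, v ∈ Λ

/-- Membership in `pathsIn`: a self-avoiding path with all its vertices in `Λ`. [folklore] -/
theorem mem_pathsIn {Λ : Finset V} {a b : V} {p : G.Walk a b} :
    p ∈ pathsIn G Λ a b ↔ p.IsPath ∧ ∀ v ∈ p.support, v ∈ Λ := by
  rw [pathsIn, mem_filter, mem_finsetWalkLengthLT_iff, and_iff_right_iff_imp]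
  rintro ⟨hp, hΛ⟩
  have h1 : #p.support.toFinset = p.length + 1 := by
    rw [List.toFinset_card_of_nodup ((Walk.isPath_def p).1 hp), Walk.length_support]
  have h2 : p.support.toFinset ⊆ Λ := fun v hv => hΛ v (List.mem_toFinset.1 hv)
  have := card_le_card h2
  omega

end General

/-! ### Half-edge bookkeeping on `ℤ²` -/

section Lattice

/-- Two half-edges carrying the same lattice edge are equal or opposite. [folklore] -/
theorem eq_or_eq_flip_of_hedge_eq {h u : Site 2 × Dir} (he : hedge h = hedge u) : h = u ∨ h = flip u := by
  obtain ⟨v, d⟩ := h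
  obtain ⟨v', d'⟩ := u
  simp only [hedge, Sym2.eq_iff] at he
  rcases he with ⟨rfl, h2⟩ | ⟨h1, h2⟩
  · left
    have : d = d' := single_signedUnit_injective (add_left_cancel h2)
    rw [this]
  · right
    subst h1
    have hvec : d.vec = (d'.opp).vec := by
      rw [Dir.vec_opp]
      have := h2
      rw [add_assoc, add_eq_left] at this
      exact eq_neg_of_add_eq_zero_right this
    have : d = d'.opp := single_signedUnit_injective hvec
    subst this
    rfl

variable {F F' : Finset (Sym2 (Site 2))}

/-- The lattice degree is monotone in the edge set. [folklore] -/
theorem ldeg_mono (hF : F' ⊆ F) (v : Site 2) : ldeg F' v ≤ ldeg F v :=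
  card_le_card (fun d hd => by
    rw [mem_filter] at hd ⊢
    exact ⟨hd.1, hF hd.2⟩)

/-- Two distinct present directions at `v` force lattice degree `≥ 2`. [folklore] -/
theorem two_le_ldeg {v : Site 2} {d d' : Dir} (hdd : d ≠ d') (hd : hedge (v, d) ∈ F)
    (hd' : hedge (v, d') ∈ F) : 2 ≤ ldeg F v := by
  rw [ldeg]
  refine (card_pair hdd).symm.le.trans (card_le_card fun x hx => ?_)
  simp only [mem_insert, mem_singleton] at hx
  rw [mem_filter]
  rcases hx with rfl | rfl
  · exact ⟨mem_univ _, hd⟩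
  · exact ⟨mem_univ _, hd'⟩

/-- Three distinct present directions at `v` force lattice degree `≥ 3`. [folklore] -/
theorem three_le_ldeg {v : Site 2} {d₁ d₂ d₃ : Dir} (h12 : d₁ ≠ d₂) (h13 : d₁ ≠ d₃) (h23 : d₂ ≠ d₃)
    (hd₁ : hedge (v, d₁) ∈ F) (hd₂ : hedge (v, d₂) ∈ F) (hd₃ : hedge (v, d₃) ∈ F) : 3 ≤ ldeg F v := by
  have hcard : #({d₁, d₂, d₃} : Finset Dir) = 3 := by
    rw [card_insert_of_notMem (by simp [h12, h13]), card_pair h23]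
  rw [ldeg]
  refine hcard.symm.le.trans (card_le_card fun x hx => ?_)
  simp only [mem_insert, mem_singleton] at hx
  rw [mem_filter]
  rcases hx with rfl | rfl | rfl
  · exact ⟨mem_univ _, hd₁⟩
  · exact ⟨mem_univ _, hd₂⟩
  · exact ⟨mem_univ _, hd₃⟩

/-- Below degree `3` the pairing rule is monotone in the edge set (no resolution is consulted).
[folklore] -/
theorem IsPaired.mono (hF : F' ⊆ F) {v : Site 2} (hdeg : ldeg F v ≤ 2) {d d' : Dir}
    (h : IsPaired F' ∅ v d d') : IsPaired F ∅ v d d' :=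
  ⟨h.1, hF h.2.1, hF h.2.2.1, fun h3 => by exfalso; omega⟩

/-- Below degree `3` matchedness is monotone in the edge set. [folklore] -/
theorem IsMatched.mono (hF : F' ⊆ F) {h : Site 2 × Dir} (hdeg : ldeg F h.1 ≤ 2)
    (hm : IsMatched F' ∅ h) : IsMatched F ∅ h := by
  obtain ⟨d', hd'⟩ := hm
  exact ⟨d', hd'.mono hF hdeg⟩

/-- Adjacency in the strand graph, unfolded. [folklore] -/
theorem strandGraph_adj {S : Finset (Site 2)} {h h' : Site 2 × Dir} :
    (strandGraph F S).Adj h h' ↔ h ≠ h' ∧ (strandRel F S h h' ∨ strandRel F S h' h) :=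
  SimpleGraph.fromRel_adj _ _ _

/-- A present half-edge is adjacent to the opposite half of its edge. [folklore] -/
theorem strandGraph_adj_flip {S : Finset (Site 2)} {h : Site 2 × Dir} (hh : hedge h ∈ F) :
    (strandGraph F S).Adj h (flip h) :=
  strandGraph_adj.2 ⟨(flip_ne_self h).symm, Or.inl ⟨hh, Or.inl rfl⟩⟩

/-- Paired half-edges at a vertex are adjacent. [folklore] -/
theorem strandGraph_adj_of_isPaired {S : Finset (Site 2)} {v : Site 2} {d d' : Dir}
    (h : IsPaired F S v d d') : (strandGraph F S).Adj (v, d) (v, d') :=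
  strandGraph_adj.2 ⟨fun he => h.1 (congrArg Prod.snd he), Or.inl ⟨h.2.1, Or.inr ⟨rfl, h⟩⟩⟩

/-- Below degree `3` the strand graph (with the trivial resolution) is monotone in the edge set.
[folklore] -/
theorem strandGraph_mono (hF : F' ⊆ F) (hdeg : ∀ v, ldeg F v ≤ 2) : strandGraph F' ∅ ≤ strandGraph F ∅ := by
  intro h h' hadj
  rw [strandGraph_adj] at hadj ⊢
  refine ⟨hadj.1, hadj.2.imp (fun hr => ?_) (fun hr => ?_)⟩
  · exact ⟨hF hr.1, hr.2.imp id fun hp => ⟨hp.1, hp.2.mono hF (hdeg _)⟩⟩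
  · exact ⟨hF hr.1, hr.2.imp id fun hp => ⟨hp.1, hp.2.mono hF (hdeg _)⟩⟩

/-- The endpoints of a present half-edge of an edge set inside `edgesIn G Λ` lie in `Λ`. [folklore] -/
theorem fst_mem_of_hedge_mem {G : SimpleGraph (Site 2)} [G.LocallyFinite] {Λ : Finset (Site 2)}
    (hF : F ⊆ edgesIn G Λ) {h : Site 2 × Dir} (hh : hedge h ∈ F) : h.1 ∈ Λ ∧ (flip h).1 ∈ Λ := by
  have := (mem_edgesIn_iff.1 (hF hh)).2
  exact ⟨this _ (Sym2.mem_mk_left _ _), this _ (Sym2.mem_mk_right _ _)⟩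

/-- **Removing a pendant edge does not close a strand.** If `F ⊆ edgesIn G Λ` has lattice degrees
`≤ 2` on `Λ` and no closed strand, and `e₀ = {a, a + d₀.vec} ∈ F` is the only edge of `F` at `a`,
then `F \ {e₀}` has no closed strand either. [folklore] -/
theorem loops_erase_eq_zero {G : SimpleGraph (Site 2)} [G.LocallyFinite] {Λ : Finset (Site 2)}
    (hF : F ⊆ edgesIn G Λ) (hdeg : ∀ v ∈ Λ, ldeg F v ≤ 2) (hl : loops Λ F ∅ = 0) {a : Site 2} {d₀ : Dir}
    (he₀ : hedge (a, d₀) ∈ F) (hdega : ldeg F a = 1) : loops Λ (F.erase (hedge (a, d₀))) ∅ = 0 := by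
  classical
  set F' := F.erase (hedge (a, d₀)) with hF'def
  have hsub : F' ⊆ F := erase_subset _ _
  have hF'Λ : F' ⊆ edgesIn G Λ := hsub.trans hF
  -- (f2): no edge of `F'` at `a`
  have hnoA : ∀ y : Site 2 × Dir, hedge y ∈ F' → y.1 ≠ a := by
    rintro ⟨v, d⟩ hy hva
    dsimp only at hva
    subst hva
    have hd : d = d₀ := by
      by_contra hne
      have := two_le_ldeg hne (hsub hy) he₀
      omega
    subst hd
    exact (mem_erase.1 hy).1 rfl
  by_contra hne
  obtain ⟨c, hc⟩ := card_pos.1 (Nat.pos_of_ne_zero hne)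
  obtain ⟨h, hh, -⟩ := mem_image.1 hc
  rw [mem_filter] at hh
  obtain ⟨hhd, hP'⟩ := hh
  -- the closed set
  set C : Set (Site 2 × Dir) := {y | y ∈ darts Λ F' ∧ (strandGraph F' ∅).Reachable h y} with hCdef
  have hstep : ∀ y ∈ C, ∀ z : Site 2 × Dir,
      (z = flip y ∨ (z.1 = y.1 ∧ IsPaired F ∅ y.1 y.2 z.2)) → z ∈ C := by
    rintro y ⟨hyd, hyr⟩ z hz
    have hyF' : hedge y ∈ F' := (mem_darts.1 hyd).2
    rcases hz with rfl | ⟨hz1, hzp⟩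
    · refine ⟨mem_darts.2 ⟨(fst_mem_of_hedge_mem hF'Λ hyF').2, by rwa [hedge_flip]⟩,
        hyr.trans (strandGraph_adj_flip hyF').reachable⟩
    · by_cases hzF' : hedge (y.1, z.2) ∈ F'
      · have hpair : IsPaired F' ∅ y.1 y.2 z.2 := ⟨hzp.1, hyF', hzF', fun h3 => by
          have := ldeg_mono hsub y.1
          have := hdeg y.1 (mem_darts.1 hyd).1
          exfalso; omega⟩
        have hz' : z = (y.1, z.2) := Prod.ext hz1 rfl
        refine ⟨mem_darts.2 ⟨hz1 ▸ (mem_darts.1 hyd).1, hz' ▸ hzF'⟩, hyr.trans ?_⟩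
        rw [hz']
        exact (strandGraph_adj_of_isPaired hpair).reachable
      · -- the partner edge is `e₀`, so `y` sits at `a` or at `a + d₀.vec`
        exfalso
        have hzF : hedge (y.1, z.2) ∈ F := hzp.2.2.1
        have hze₀ : hedge (y.1, z.2) = hedge (a, d₀) := by
          by_contra hne'
          exact hzF' (mem_erase.2 ⟨hne', hzF⟩)
        rcases eq_or_eq_flip_of_hedge_eq hze₀ with hya | hyv
        · exact hnoA y hyF' (congrArg Prod.fst hya)
        · -- `y` is at `v = a + d₀.vec`, is `F'`-matched, and `e₀` is a third edge at `v`
          obtain ⟨d'', hd''⟩ := hP' y hyd hyr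
          have h1 : (y.1, z.2) = flip (a, d₀) := hyv
          have hy1 : y.1 = a + d₀.vec := congrArg Prod.fst h1
          have hz2 : z.2 = d₀.opp := congrArg Prod.snd h1
          have hA : hedge (y.1, y.2) ∈ F := hsub hd''.2.1
          have hB : hedge (y.1, d'') ∈ F := hsub hd''.2.2.1
          have hne1 : y.2 ≠ z.2 := fun he => hzF' (he ▸ hd''.2.1)
          have hne2 : d'' ≠ z.2 := fun he => hzF' (he ▸ hd''.2.2.1)
          have h3 := three_le_ldeg hd''.1 hne1 hne2 hA hB hzF
          have := hdeg y.1 (mem_darts.1 hyd).1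
          omega
  have hclosed : ∀ y ∈ C, ∀ z, (strandGraph F ∅).Adj y z → z ∈ C := by
    intro y hy z hadj
    rw [strandGraph_adj] at hadj
    rcases hadj.2 with ⟨-, hr⟩ | ⟨-, hr⟩
    · exact hstep y hy z hr
    · refine hstep y hy z (hr.imp (fun h' => ?_) fun h' => ⟨h'.1.symm, ?_⟩)
      · rw [h', flip_flip]
      · rw [h'.1]
        exact h'.2.symm
  have hhC : h ∈ C := ⟨hhd, Reachable.refl _⟩
  -- a closed set contains everything reachable from it (cf. `mem_of_reachable_of_closed` of
  -- `RandomClusterPinnedComparison.lean`, not imported here)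
  have hreachC : ∀ {x y : Site 2 × Dir}, (strandGraph F ∅).Walk x y → x ∈ C → y ∈ C := by
    intro x y w
    induction w with
    | nil => exact id
    | cons hadj w' ih => exact fun hx => ih (hclosed _ hx _ hadj)
  -- `h` witnesses a closed strand of `F`
  have hcontra : 0 < loops Λ F ∅ := by
    refine card_pos.2 ⟨(strandGraph F ∅).connectedComponentMk h, mem_image.2 ⟨h, ?_, rfl⟩⟩
    refine mem_filter.2 ⟨mem_darts.2 ⟨(mem_darts.1 hhd).1, hsub (mem_darts.1 hhd).2⟩, ?_⟩
    intro h' hh' hreach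
    obtain ⟨w⟩ := hreach
    have hh'C : h' ∈ C := hreachC w hhC
    exact (hP' h' hh'C.1 hh'C.2).mono hsub (hdeg _ (mem_darts.1 hh').1)
  omega

/-! ### The edge set of a self-avoiding path of a subgraph of `ℤ²` -/

variable {G : SimpleGraph (Site 2)}

/-- An edge of `G ≤ ℤ²` at `a` is `{a, a + d.vec}` for some direction `d`. [folklore] -/
theorem exists_dir_of_adj (hG : G ≤ zdGraph 2) {a v : Site 2} (h : G.Adj a v) : ∃ d : Dir, v = a + d.vec :=
  Dir.zdGraph_adj_iff_exists_vec.1 (hG h)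

/-- The edges of a walk in `G ≤ ℤ²` are lattice edges. [folklore] -/
theorem edges_toFinset_lattice (hG : G ≤ zdGraph 2) {a b : Site 2} (p : G.Walk a b) :
    ∀ e ∈ p.edges.toFinset, e ∈ (zdGraph 2).edgeSet := fun _ he =>
  edgeSet_subset_edgeSet.2 hG (p.edges_subset_edgeSet (List.mem_toFinset.1 he))

/-- A self-avoiding path of `G ≤ ℤ²` has lattice degree `≤ 2` everywhere. [folklore] -/
theorem ldeg_edges_le_two (hG : G ≤ zdGraph 2) {a b : Site 2} {p : G.Walk a b} (hp : p.IsPath)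
    (v : Site 2) : ldeg p.edges.toFinset v ≤ 2 := by
  rw [ldeg_eq_card_filter (edges_toFinset_lattice hG p)]
  exact IsPath.card_filter_mem_edges_le_two hp v

/-- A self-avoiding path of `G ≤ ℤ²` has lattice degree `1` at its start. [folklore] -/
theorem ldeg_edges_start (hG : G ≤ zdGraph 2) {a b : Site 2} {p : G.Walk a b} (hp : p.IsPath)
    (hab : a ≠ b) : ldeg p.edges.toFinset a = 1 := by
  rw [ldeg_eq_card_filter (edges_toFinset_lattice hG p)]
  exact IsPath.card_filter_mem_edges_start hp hab

/-- **No collisions on a self-avoiding path.** [folklore] -/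
theorem oscVerts_edges_eq_empty (hG : G ≤ zdGraph 2) {a b : Site 2} {p : G.Walk a b} (hp : p.IsPath)
    (Λ : Finset (Site 2)) : oscVerts Λ p.edges.toFinset = ∅ := by
  rw [← Finset.not_nonempty_iff_eq_empty]
  rintro ⟨v, hv⟩
  have := (mem_oscVerts.1 hv).2
  have := ldeg_edges_le_two hG hp v
  omega

/-- **The edge set of a self-avoiding path inside `Λ` from `a` to `b ≠ a` is an admissible
configuration with source set `{a} ∆ {b}`.** [folklore] -/
theorem edgesFinset_mem_configs [G.LocallyFinite] {Λ : Finset (Site 2)} {a b : Site 2} {p : G.Walk a b} (hp : p.IsPath)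
    (hab : a ≠ b) (hΛ : ∀ v ∈ p.support, v ∈ Λ) : p.edges.toFinset ∈ configs G Λ ({a} ∆ {b}) := by
  rw [mem_configs]
  refine ⟨fun e he => mem_edgesIn_iff.2 ⟨p.edges_subset_edgeSet (List.mem_toFinset.1 he), fun x hx =>
    hΛ x (Walk.mem_support_iff_exists_mem_edges.2 (Or.inr ⟨e, List.mem_toFinset.1 he, hx⟩))⟩, ?_⟩
  ext z
  rw [mem_filter, IsPath.odd_card_filter_mem_edges_iff hp hab, mem_symmDiff, mem_singleton,
    mem_singleton]
  constructor
  · rintro ⟨-, rfl | rfl⟩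
    · exact Or.inl ⟨rfl, hab⟩
    · exact Or.inr ⟨rfl, Ne.symm hab⟩
  · rintro (⟨rfl, -⟩ | ⟨rfl, -⟩)
    · exact ⟨hΛ _ p.start_mem_support, Or.inl rfl⟩
    · exact ⟨hΛ _ p.end_mem_support, Or.inr rfl⟩

/-- **Every half-edge of a self-avoiding path is joined, in the strand graph, to the tip at the
start** (the open strand runs through the whole path). [folklore] -/
theorem reachable_start_of_mem_edges (hG : G ≤ zdGraph 2) :
    ∀ {a b : Site 2} {p : G.Walk a b}, p.IsPath → ∀ (h : Site 2 × Dir) (d : Dir),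
      hedge h ∈ p.edges.toFinset → hedge (a, d) ∈ p.edges.toFinset →
      (strandGraph p.edges.toFinset ∅).Reachable h (a, d) := by
  intro a b p
  induction p with
  | nil => intro _ h d hh; simp at hh
  | @cons a v b hav p' ih =>
    intro hp h d hh hd
    have hp' := (Walk.cons_isPath_iff _ _).1 hp
    have hdeg : ∀ v, ldeg (Walk.cons hav p').edges.toFinset v ≤ 2 := ldeg_edges_le_two hG hp
    -- the edge at `a` is the first edge, `v = a + d.vec`
    have hnot : ∀ {w : Site 2}, s(a, w) ∉ p'.edges.toFinset := fun he =>
      hp'.2 (Walk.fst_mem_support_of_mem_edges p' (List.mem_toFinset.1 he))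
    have hd' : hedge (a, d) = s(a, v) := by
      simp only [Walk.edges_cons, List.toFinset_cons, mem_insert] at hd
      rcases hd with hd | hd
      · exact hd
      · exact absurd hd hnot
    have hv : v = a + d.vec := by
      rcases Sym2.eq_iff.1 hd' with ⟨-, h2⟩ | ⟨h1, -⟩
      · exact h2.symm
      · exact absurd h1 hav.ne
    have hdF : hedge (a, d) ∈ (Walk.cons hav p').edges.toFinset := by
      rw [hd']; simp
    have hflip : (strandGraph (Walk.cons hav p').edges.toFinset ∅).Reachable (flip (a, d)) (a, d) := by
      have := (strandGraph_adj_flip (S := ∅) hdF).symm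
      exact this.reachable
    simp only [Walk.edges_cons, List.toFinset_cons, mem_insert] at hh
    by_cases hha : hedge h = s(a, v)
    · rcases eq_or_eq_flip_of_hedge_eq (hha.trans hd'.symm) with rfl | rfl
      · rfl
      · exact hflip
    · have hh' : hedge h ∈ p'.edges.toFinset := hh.resolve_left hha
      -- `p'` is not trivial; its first half-edge at `v`
      cases p' with
      | nil => simp at hh'
      | @cons _ w _ hvw p'' =>
        obtain ⟨d₁, hw⟩ := exists_dir_of_adj hG hvw
        have hd₁ : hedge (v, d₁) ∈ (Walk.cons hvw p'').edges.toFinset := by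
          rw [show hedge (v, d₁) = s(v, w) by rw [hw]; rfl]; simp
        have hreach := ih hp'.1 h d₁ hh' hd₁
        have hsub : (Walk.cons hvw p'').edges.toFinset ⊆ (Walk.cons hav (Walk.cons hvw p'')).edges.toFinset := by
          intro e he
          simp only [Walk.edges_cons, List.toFinset_cons, mem_insert] at he ⊢
          exact Or.inr he
        refine ((hreach.mono (strandGraph_mono hsub hdeg)).trans ?_).trans hflip
        -- `(v, d₁)` is paired at `v` with `flip (a, d) = (v, d.opp)`
        have hfl : flip (a, d) = (v, d.opp) := by rw [flip, hv]
        rw [hfl]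
        refine (strandGraph_adj_of_isPaired ⟨fun he => ?_, hsub hd₁, ?_, fun h3 => ?_⟩).reachable
        · apply hnot (w := v)
          have : hedge (v, d₁) = s(a, v) := by rw [he, ← hd', ← hedge_flip (a, d), hfl]
          exact this ▸ hd₁
        · rw [← hfl, hedge_flip]; exact hdF
        · exfalso
          have := hdeg v
          omega

/-- **No closed strand on a self-avoiding path** (from `a ∈ Λ` to `b ≠ a`). [folklore] -/
theorem loops_edges_eq_zero (hG : G ≤ zdGraph 2) {Λ : Finset (Site 2)} {a b : Site 2} {p : G.Walk a b}
    (hp : p.IsPath) (hab : a ≠ b) (ha : a ∈ Λ) : loops Λ p.edges.toFinset ∅ = 0 := by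
  classical
  by_contra hne
  obtain ⟨c, hc⟩ := card_pos.1 (Nat.pos_of_ne_zero hne)
  obtain ⟨h, hh, -⟩ := mem_image.1 hc
  rw [mem_filter] at hh
  obtain ⟨hhd, hP⟩ := hh
  -- the tip at `a`
  cases p with
  | nil => exact hab rfl
  | @cons _ v _ hav p' =>
    obtain ⟨d₀, hv⟩ := exists_dir_of_adj hG hav
    have hd₀ : hedge (a, d₀) ∈ (Walk.cons hav p').edges.toFinset := by
      rw [show hedge (a, d₀) = s(a, v) by rw [hv]; rfl]; simp
    have hreach := reachable_start_of_mem_edges hG hp h d₀ (mem_darts.1 hhd).2 hd₀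
    obtain ⟨d', hd'⟩ := hP (a, d₀) (mem_darts.2 ⟨ha, hd₀⟩) hreach
    have h2 := two_le_ldeg hd'.1 hd'.2.1 hd'.2.2.1
    have h1 := ldeg_edges_start hG hp hab
    simp only at h2
    omega

/-- Parity bookkeeping: removing the edge `{a, v}` at the degree-one source `a` of an admissible
configuration with sources `{a} ∆ {b}` leaves an admissible configuration with sources `{v} ∆ {b}`.
[folklore] -/
theorem erase_mem_configs [G.LocallyFinite] {Λ : Finset (Site 2)} {a b v : Site 2} {F : Finset (Sym2 (Site 2))}
    (hF : F ∈ configs G Λ ({a} ∆ {b})) (hab : a ≠ b) (hav : a ≠ v) (hv : v ∈ Λ) (he₀ : s(a, v) ∈ F)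
    (hdega : #(F.filter fun e => a ∈ e) = 1) (hdegv : #(F.filter fun e => v ∈ e) ≤ 2) :
    F.erase s(a, v) ∈ configs G Λ ({v} ∆ {b}) := by
  rw [mem_configs] at hF ⊢
  refine ⟨(erase_subset _ _).trans hF.1, ?_⟩
  -- the old source set, pointwise
  have hsrc : ∀ z, (z ∈ Λ ∧ Odd #(F.filter fun e => z ∈ e)) ↔ (z = a ∨ z = b) := fun z => by
    have h := congrArg (z ∈ ·) hF.2
    simp only [eq_iff_iff] at h
    rw [mem_filter, mem_symmDiff, mem_singleton, mem_singleton] at h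
    rw [h]
    constructor
    · rintro (⟨h1, -⟩ | ⟨h1, -⟩)
      · exact Or.inl h1
      · exact Or.inr h1
    · rintro (h1 | h1)
      · exact Or.inl ⟨h1, fun h2 => hab (h1.symm.trans h2)⟩
      · exact Or.inr ⟨h1, fun h2 => hab (h2.symm.trans h1)⟩
  have hbΛ : b ∈ Λ := ((hsrc b).2 (Or.inr rfl)).1
  have hdegv1 : 1 ≤ #(F.filter fun e => v ∈ e) :=
    card_pos.2 ⟨_, mem_filter.2 ⟨he₀, Sym2.mem_mk_right _ _⟩⟩
  have hcount : ∀ z, #((F.erase s(a, v)).filter fun e => z ∈ e) =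
      #(F.filter fun e => z ∈ e) - if z ∈ s(a, v) then 1 else 0 := fun z => by
    rw [filter_erase]
    split_ifs with hz
    · rw [card_erase_of_mem (mem_filter.2 ⟨he₀, hz⟩)]
    · have hnm : s(a, v) ∉ F.filter fun e => z ∈ e := fun h => hz (mem_filter.1 h).2
      rw [erase_eq_of_notMem hnm, Nat.sub_zero]
  ext z
  rw [mem_filter, hcount, mem_symmDiff, mem_singleton, mem_singleton, Nat.odd_iff]
  by_cases hza : z = a
  · -- `a` loses its only edge
    rw [if_pos (hza ▸ Sym2.mem_mk_left a v), hza, hdega]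
    constructor
    · rintro ⟨-, h⟩
      exact absurd h (by decide)
    · rintro (⟨h, -⟩ | ⟨h, -⟩)
      · exact absurd h hav
      · exact absurd h hab
  by_cases hzv : z = v
  · -- `v` loses one of its edges
    rw [if_pos (hzv ▸ Sym2.mem_mk_right a v), hzv]
    have hvodd : Odd #(F.filter fun e => v ∈ e) ↔ v = b := by
      constructor
      · intro h
        rcases (hsrc v).1 ⟨hv, h⟩ with h1 | h1
        · exact absurd h1.symm hav
        · exact h1
      · intro h
        exact ((hsrc v).2 (Or.inr h)).2
    rw [Nat.odd_iff] at hvodd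
    constructor
    · rintro ⟨-, h⟩
      refine Or.inl ⟨rfl, fun hvb => ?_⟩
      have := hvodd.2 hvb
      omega
    · rintro (⟨-, hvb⟩ | ⟨hvb, hvv⟩)
      · refine ⟨hv, ?_⟩
        have : ¬(#(F.filter fun e => v ∈ e) % 2 = 1) := fun h => hvb (hvodd.1 h)
        omega
      · exact absurd rfl hvv
  · -- elsewhere nothing changes
    have hzn : z ∉ s(a, v) := by
      rw [Sym2.mem_iff]
      rintro (h | h)
      · exact hza h
      · exact hzv h
    rw [if_neg hzn, Nat.sub_zero, ← Nat.odd_iff, hsrc z]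
    constructor
    · rintro (h | h)
      · exact absurd h hza
      · exact Or.inr ⟨h, hzv⟩
    · rintro (⟨h, -⟩ | ⟨h, -⟩)
      · exact absurd h hzv
      · exact Or.inr h

/-- **Every admissible, collision-free, loop-free configuration with sources `{a, b}` on a subgraph
of `ℤ²` is the edge set of a self-avoiding path from `a` to `b` inside the volume.** [folklore] -/
theorem exists_path_of_loopfree [G.LocallyFinite] (hG : G ≤ zdGraph 2) {Λ : Finset (Site 2)} {b : Site 2} :
    ∀ (n : ℕ) (F : Finset (Sym2 (Site 2))) (a : Site 2), #F = n → a ≠ b →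
      F ∈ configs G Λ ({a} ∆ {b}) → oscVerts Λ F = ∅ → loops Λ F ∅ = 0 →
      ∃ p : G.Walk a b, p.IsPath ∧ (∀ v ∈ p.support, v ∈ Λ) ∧ p.edges.toFinset = F := by
  intro n
  induction n using Nat.strong_induction_on with
  | _ n ih =>
  intro F a hn hab hF hosc hl
  have hF' := mem_configs.1 hF
  have hlat : ∀ e ∈ F, e ∈ (zdGraph 2).edgeSet := fun e he =>
    edgeSet_subset_edgeSet.2 hG (mem_edgesIn_iff.1 (hF'.1 he)).1
  have hdeg : ∀ v ∈ Λ, ldeg F v ≤ 2 := fun v hv => by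
    by_contra h
    have : v ∈ oscVerts Λ F := mem_oscVerts.2 ⟨hv, by omega⟩
    rw [hosc] at this
    exact notMem_empty _ this
  -- `a` is a source of degree one
  have haΛodd : a ∈ Λ ∧ Odd #(F.filter fun e => a ∈ e) := by
    have h := congrArg (a ∈ ·) hF'.2
    simp only [eq_iff_iff] at h
    rw [mem_filter, mem_symmDiff, mem_singleton, mem_singleton] at h
    exact h.2 (Or.inl ⟨rfl, hab⟩)
  obtain ⟨ha, haodd⟩ := haΛodd
  have hdega : ldeg F a = 1 := by
    have h2 := hdeg a ha
    rw [ldeg_eq_card_filter hlat] at h2 ⊢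
    obtain ⟨k, hk⟩ := haodd
    omega
  obtain ⟨d₀, hd₀⟩ : ∃ d₀, hedge (a, d₀) ∈ F := by
    obtain ⟨d₀, hd₀⟩ := card_pos.1 (show 0 < ldeg F a by omega)
    exact ⟨d₀, (mem_filter.1 hd₀).2⟩
  set v := a + d₀.vec with hvdef
  have he₀ : hedge (a, d₀) = s(a, v) := rfl
  have he₀Λ := mem_edgesIn_iff.1 (hF'.1 hd₀)
  have hadj : G.Adj a v := by simpa [he₀] using he₀Λ.1
  have hvΛ : v ∈ Λ := he₀Λ.2 v (by simp [he₀])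
  -- the smaller configuration
  set F₁ := F.erase (hedge (a, d₀)) with hF₁def
  have hcard : #F₁ < n := by
    rw [hF₁def, card_erase_of_mem hd₀, hn]
    exact Nat.sub_one_lt (by rw [← hn]; exact card_ne_zero_of_mem hd₀)
  have hF₁conf : F₁ ∈ configs G Λ ({v} ∆ {b}) := by
    rw [hF₁def, he₀]
    refine erase_mem_configs hF hab hadj.ne hvΛ (he₀ ▸ hd₀) ?_ ?_
    · rw [← ldeg_eq_card_filter hlat]; exact hdega
    · rw [← ldeg_eq_card_filter hlat]; exact hdeg v hvΛ
  have hF₁osc : oscVerts Λ F₁ = ∅ := by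
    rw [← Finset.not_nonempty_iff_eq_empty]
    rintro ⟨z, hz⟩
    rw [mem_oscVerts] at hz
    have h1 : ldeg F₁ z ≤ ldeg F z := ldeg_mono (erase_subset _ _) z
    have h2 := hdeg z hz.1
    omega
  have hF₁loops : loops Λ F₁ ∅ = 0 := loops_erase_eq_zero hF'.1 hdeg hl hd₀ hdega
  have haF₁ : ∀ e ∈ F₁, a ∉ e := by
    intro e he hae
    obtain ⟨hne, heF⟩ := mem_erase.1 he
    obtain ⟨u, rfl⟩ := Sym2.mem_iff_exists.1 hae
    have hadj' : (zdGraph 2).Adj a u := by simpa using hlat _ heF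
    obtain ⟨d, rfl⟩ := Dir.zdGraph_adj_iff_exists_vec.1 hadj'
    by_cases hdd : d = d₀
    · exact hne (by rw [hdd]; rfl)
    · have := two_le_ldeg hdd (show hedge (a, d) ∈ F from heF) hd₀
      omega
  by_cases hvb : v = b
  · -- the pendant edge is the whole configuration
    have hF₁empty : F₁ = ∅ := by
      by_contra hne
      have hconf : F₁ ∈ configs G Λ ∅ := by rwa [hvb, symmDiff_self, Finset.bot_eq_empty] at hF₁conf
      refine (loops_pos_of_even (S := ∅) (fun e he => ?_) (nonempty_iff_ne_empty.2 hne) (fun z hz => ?_)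
        hF₁osc).ne' hF₁loops
      · have := mem_edgesIn_iff.1 ((mem_configs.1 hconf).1 he)
        exact ⟨edgeSet_subset_edgeSet.2 hG this.1, this.2⟩
      · have h0 : z ∉ Λ.filter fun v => Odd #(F₁.filter fun e => v ∈ e) := by
          rw [(mem_configs.1 hconf).2]; exact notMem_empty z
        rw [mem_filter, not_and] at h0
        exact Nat.not_odd_iff_even.1 (h0 hz)
    subst hvb
    refine ⟨Walk.cons hadj Walk.nil, ?_, ?_, ?_⟩
    · exact Walk.IsPath.cons Walk.IsPath.nil (by simp [hab])
    · intro z hz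
      simp only [Walk.support_cons, Walk.support_nil, List.mem_cons, List.not_mem_nil, or_false] at hz
      rcases hz with rfl | rfl
      · exact ha
      · exact hvΛ
    · rw [Walk.edges_cons, Walk.edges_nil, ← insert_erase hd₀, ← hF₁def, hF₁empty]
      simp [he₀]
  · obtain ⟨p', hp', hp'Λ, hp'E⟩ := ih _ hcard F₁ v rfl hvb hF₁conf hF₁osc hF₁loops
    have haS : a ∉ p'.support := fun has => by
      have hnn : ¬p'.Nil := fun hnil => hvb hnil.eq
      obtain ⟨e, he, hae⟩ := (Walk.mem_support_iff_exists_mem_edges_of_not_nil hnn).1 has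
      exact haF₁ e (hp'E ▸ List.mem_toFinset.2 he) hae
    refine ⟨Walk.cons hadj p', hp'.cons haS, ?_, ?_⟩
    · intro z hz
      rw [Walk.support_cons, List.mem_cons] at hz
      rcases hz with rfl | hz
      · exact ha
      · exact hp'Λ z hz
    · rw [Walk.edges_cons, List.toFinset_cons, hp'E, hF₁def, he₀, insert_erase (he₀ ▸ hd₀)]

/-! ### The identities -/

/-- **`Z_{0,0,x}(G, Λ; {a} ∆ {b}) = Σ_{γ ∈ pathsIn G Λ a b} x^{|γ|}`**: at `n = w = 0` the dilute
non-crossing loop model with two legs at `a ≠ b` on a subgraph `G` of `ℤ²` is the two-point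
generating function of the self-avoiding paths of `G` from `a` to `b` inside `Λ`.
[cite: MadrasSlade1993, §1.2] [cite: Jacobsen2009, §14.3.1] -/
theorem partitionFunction_zero_zero_eq_sum_paths [G.LocallyFinite] {R : Type*} [CommSemiring R] (hG : G ≤ zdGraph 2)
    (x : R) (Λ : Finset (Site 2)) {a b : Site 2} (hab : a ≠ b) :
    (⟨0, 0, x⟩ : DiluteLoopModel R).partitionFunction G Λ ({a} ∆ {b}) =
      ∑ p ∈ pathsIn G Λ a b, x ^ p.length := by
  classical
  rw [partitionFunction_zero_zero]
  symm
  refine sum_nbij (fun p => p.edges.toFinset) (fun p hp => ?_) (fun p hp q hq hpq => ?_)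
    (fun F hF => ?_) (fun p hp => ?_)
  · rw [mem_pathsIn] at hp
    exact mem_filter.2 ⟨edgesFinset_mem_configs hp.1 hab hp.2, oscVerts_edges_eq_empty hG hp.1 Λ,
      loops_edges_eq_zero hG hp.1 hab (hp.2 _ p.start_mem_support)⟩
  · rw [mem_coe, mem_pathsIn] at hp hq
    exact IsPath.eq_of_edges_toFinset_eq hp.1 hq.1 hpq
  · rw [mem_coe, mem_filter] at hF
    obtain ⟨p, hp, hpΛ, hpE⟩ := exists_path_of_loopfree hG _ F a rfl hab hF.1 hF.2.1 hF.2.2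
    exact ⟨p, by rw [mem_coe, mem_pathsIn]; exact ⟨hp, hpΛ⟩, hpE⟩
  · rw [mem_pathsIn] at hp
    rw [IsPath.card_edges_toFinset hp.1]

/-- **`twoLeg ⟨0, 0, x⟩ G Λ a b = Σ_{γ ∈ pathsIn G Λ a b} x^{|γ|}`** (the source-free `n = w = 0`
partition function is `1`). [cite: MadrasSlade1993, §1.2] -/
theorem twoLeg_zero_zero_eq_sum_paths [G.LocallyFinite] {K : Type*} [Field K] (hG : G ≤ zdGraph 2) (x : K)
    (Λ : Finset (Site 2)) {a b : Site 2} (hab : a ≠ b) :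
    (⟨0, 0, x⟩ : DiluteLoopModel K).twoLeg G Λ a b = ∑ p ∈ pathsIn G Λ a b, x ^ p.length := by
  rw [twoLeg, partitionFunction_zero_zero_eq_sum_paths hG x Λ hab, partitionFunction_zero_zero_empty hG,
    div_one]

/-- A walk of `Ω_δ` from a vertex of `Ω_δ` stays in `Ω_δ`. [cite: ChelkakSmirnov2012, §1.2] -/
theorem support_subset_meshDomain {Ω : Set ℂ} {δ : ℝ} {a b : Site 2}
    (p : (discreteDomainGraph Ω δ).Walk a b) (ha : a ∈ meshDomain Ω δ) :
    ∀ v ∈ p.support, v ∈ meshDomain Ω δ := by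
  induction p with
  | nil => intro v hv; simp only [Walk.support_nil, List.mem_singleton] at hv; exact hv ▸ ha
  | cons h p' ih =>
    intro v hv
    rw [Walk.support_cons, List.mem_cons] at hv
    rcases hv with rfl | hv
    · exact ha
    · exact ih (discreteDomainGraph_adj_iff.1 h).2.2 v hv

/-- On `Ω_δ`, for a vertex `a` of `Ω_δ` (bounded `Ω`, `δ > 0` — automatic from
`a ∈ meshDomainFinset Ω δ`), `pathsIn` with volume `meshDomainFinset Ω δ` is the set of ALL
self-avoiding paths from `a` to `b` (the `DomainSAW Ω δ a b` of `SelfAvoidingWalk.lean`).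
[cite: DuminilCopinSmirnov2012, §4 (before Conjecture 1)] -/
theorem mem_pathsIn_discreteDomainGraph {Ω : Set ℂ} {δ : ℝ} {a b : Site 2} (ha : a ∈ meshDomainFinset Ω δ)
    {p : (discreteDomainGraph Ω δ).Walk a b} :
    p ∈ pathsIn (discreteDomainGraph Ω δ) (meshDomainFinset Ω δ) a b ↔ p.IsPath := by
  classical
  have hcond : Bornology.IsBounded Ω ∧ 0 < δ := by
    by_contra h
    simp [meshDomainFinset, h] at ha
  have hcoe := coe_meshDomainFinset hcond.1 hcond.2
  rw [mem_pathsIn, and_iff_left_iff_imp]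
  intro _ v hv
  rw [← mem_coe, hcoe]
  exact support_subset_meshDomain p (by rw [← hcoe]; exact ha) v hv

/-- **`Z_{0,0,x}(Ω_δ; {a} ∆ {b}) = Σ_γ x^{|γ|}` over all self-avoiding paths `γ` of `Ω_δ` from
`a` to `b`** (`a ≠ b`, `a` a vertex of `Ω_δ`): at `x = x_c = μ⁻¹` this is the total mass of the
critical SAW measure `SAW.weight Ω δ a b`, and `domainTwoLeg ⟨0, 0, x_c⟩ Ω δ a b` equals it
(`partitionFunction_zero_zero_empty`). [cite: DuminilCopinSmirnov2012, §4 (before Conjecture 1)] -/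
theorem domainPartitionFunction_zero_zero_eq_sum_paths {R : Type*} [CommSemiring R] (x : R) {Ω : Set ℂ}
    {δ : ℝ} {a b : Site 2} (hab : a ≠ b) :
    (⟨0, 0, x⟩ : DiluteLoopModel R).domainPartitionFunction Ω δ ({a} ∆ {b}) =
      ∑ p ∈ pathsIn (discreteDomainGraph Ω δ) (meshDomainFinset Ω δ) a b, x ^ p.length :=
  partitionFunction_zero_zero_eq_sum_paths
    ((discreteDomainGraph_le_meshGraph Ω δ).trans (meshGraph_le_zdGraph Ω δ)) x _ hab

/-- The source-free `n = w = 0` partition function of `Ω_δ` is `1`. [folklore] -/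
theorem domainPartitionFunction_zero_zero_empty {R : Type*} [CommSemiring R] (x : R) (Ω : Set ℂ) (δ : ℝ) :
    (⟨0, 0, x⟩ : DiluteLoopModel R).domainPartitionFunction Ω δ ∅ = 1 :=
  partitionFunction_zero_zero_empty
    ((discreteDomainGraph_le_meshGraph Ω δ).trans (meshGraph_le_zdGraph Ω δ)) x _

end Lattice

end Literature.Probability.LatticeModels.DiluteLoopModel
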